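import Literature.NumberTheory.GaloisRepresentations.TateDualityCounting
import Literature.NumberTheory.GaloisRepresentations.BrauerTower
import Literature.NumberTheory.GaloisRepresentations.PPrimaryDevissage
import HarnessLib

/-!
# The `(0, 2)` input of the local duality dévissage: `H²(G, Hom(W, Ω)) ↪ Hom(W, ℤ/n)`

The dévissage `ContinuousRep.dualityPairing_injective_of_devissage` (`TateDualityDevissage.lean`)
needs, for every discrete `G`-module `W` of prime order `p` with trivial action, that a class
`z ∈ H²(G, W^D)`, `W^D = Hom(W, Ω)`, with `ι(H²(⟨w, ·⟩) z) = 0` for all `w ∈ W` vanishes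
(hypothesis `h02`).  We reduce this to two inputs on the coefficient module `Ω` alone
(`zeroTwo_eq_zero_of_torsionIncl_injective`):

* `ι : H²(G, Ω) → ℤ/n` is injective;
* `H²(G, Ω[p]) → H²(G, Ω)` is injective, `Ω[p] = Submodule.torsionBy ℤ Ω p` the `p`-torsion
  submodule (`torsionRep`, `torsionIncl`).

Indeed `W ≅ ℤ/p` (generator `w₀`), and `f ↦ f(w₀)` is an isomorphism of `G`-modules
`Hom(W, Ω) ≅ Ω[p]` (`lineHomIso`) through which `⟨w₀, ·⟩ : Hom(W, Ω) → Ω` is the inclusion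
`Ω[p] ⊆ Ω`.  For `G = Gal(F̄/E)`, `Ω = μ_n`: `Ω[p] = μ_p` and both inputs are the injectivity of
the Kummer maps (`LocalKummerIota.lean`).

## References
* J.-P. Serre, *Galois Cohomology*, Springer, 1997, II §5.2 (proof of Thm. 2). [SerreGaloisCohomology1997]
* J. S. Milne, *Arithmetic Duality Theorems*, 2006, I §2 (Thm. 2.3, Cor. 2.3). [MilneADT2006]
-/

noncomputable section

open CategoryTheory Function

universe u

namespace Literature.NumberTheory.GaloisRepresentations

open _root_.TopRep _root_.ContRepresentation _root_.ContinuousCohomology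

/-! ### The `p`-torsion sub-representation -/

namespace ContinuousRep

section Torsion

variable {G : Type u} [Group G] [TopologicalSpace G] [IsTopologicalGroup G]
variable {Ω : Type u} [AddCommGroup Ω] [TopologicalSpace Ω] [DiscreteTopology Ω]
variable (ω : ContinuousRep G ℤ Ω) (p : ℕ)

omit [TopologicalSpace Ω] [DiscreteTopology Ω] in
/-- Membership in the `p`-torsion submodule `Ω[p] = Submodule.torsionBy ℤ Ω p` in terms of `p • x`.
[folklore] -/
theorem mem_torsionBy_nsmul_iff {x : Ω} : x ∈ Submodule.torsionBy ℤ Ω (p : ℤ) ↔ p • x = 0 := by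
  rw [Submodule.mem_torsionBy_iff, natCast_zsmul]

omit [IsTopologicalGroup G] [DiscreteTopology Ω] in
/-- `Ω[p]` is `G`-stable. [folklore] -/
theorem torsionBy_le_comap (g : G) :
    Submodule.torsionBy ℤ Ω (p : ℤ) ≤ (Submodule.torsionBy ℤ Ω (p : ℤ)).comap (ω g) := fun x hx => by
  rw [Submodule.mem_comap, mem_torsionBy_nsmul_iff, ← map_nsmul, (mem_torsionBy_nsmul_iff p).1 hx, map_zero]

/-- **The `p`-torsion sub-representation `Ω[p]`** (on Mathlib's `Submodule.torsionBy ℤ Ω p`, as the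
tree's `DiscreteGaloisModule.torsionBy`). [folklore] -/
abbrev torsionRep : ContinuousRep G ℤ (Submodule.torsionBy ℤ Ω (p : ℤ)) :=
  ω.subrepresentation (Submodule.torsionBy ℤ Ω (p : ℤ)) (ω.torsionBy_le_comap p)

/-- **The inclusion `Ω[p] → Ω`** as a morphism of topological representations. [folklore] -/
abbrev torsionIncl : (ω.torsionRep p).toTopRep ⟶ ω.toTopRep :=
  subtypeHom ω (Submodule.torsionBy ℤ Ω (p : ℤ)) (ω.torsionBy_le_comap p)

end Torsion

/-! ### Lines: trivial modules of prime order -/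

section Line

variable {G : Type u} [Group G] [TopologicalSpace G] [IsTopologicalGroup G]
variable {Ω : Type u} [AddCommGroup Ω] [TopologicalSpace Ω] [DiscreteTopology Ω]
variable {W : Type u} [AddCommGroup W] [TopologicalSpace W] [DiscreteTopology W] [Finite W]
variable (τ : ContinuousRep G ℤ W) (ω : ContinuousRep G ℤ Ω)
variable {p : ℕ} [hp : Fact p.Prime]

omit [TopologicalSpace W] [DiscreteTopology W] [Finite W] in
/-- A group of prime order has a nonzero element. [folklore] -/
theorem exists_ne_zero_of_card (hW : Nat.card W = p) : ∃ w₀ : W, w₀ ≠ 0 := by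
  by_contra h
  have h' : ∀ w : W, w = 0 := fun w => Classical.byContradiction fun hw => h ⟨w, hw⟩
  haveI : Subsingleton W := ⟨fun a b => by rw [h' a, h' b]⟩
  have h1 : Nat.card W = 1 := Nat.card_of_subsingleton (0 : W)
  rw [hW] at h1
  exact hp.out.one_lt.ne' h1

omit [TopologicalSpace W] [DiscreteTopology W] in
/-- A nonzero element of a group of prime order generates it. [folklore] -/
theorem forall_mem_zmultiples_of_card (hW : Nat.card W = p) {w₀ : W} (hw₀ : w₀ ≠ 0) :
    ∀ w : W, w ∈ AddSubgroup.zmultiples w₀ := by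
  have hord : addOrderOf w₀ = p := by
    have h := addOrderOf_dvd_natCard w₀
    rw [hW, Nat.dvd_prime hp.out] at h
    exact h.resolve_left fun h1 => hw₀ (AddMonoid.addOrderOf_eq_one_iff.1 h1)
  have htop : AddSubgroup.zmultiples w₀ = ⊤ := by
    apply AddSubgroup.eq_top_of_card_eq
    rw [Nat.card_zmultiples, hord, hW]
  intro w
  rw [htop]
  exact AddSubgroup.mem_top w

/-- **The coordinate `W ≃ ℤ/p` attached to a nonzero `w₀`**, `w₀ ↦ 1`. [folklore] -/
def lineCoord (hW : Nat.card W = p) {w₀ : W} (hw₀ : w₀ ≠ 0) : W ≃+ ZMod p :=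
  (zmodAddEquivOfGenerator (forall_mem_zmultiples_of_card hW hw₀) hW).symm

omit [TopologicalSpace W] [DiscreteTopology W] in
/-- `lineCoord w₀ = 1`. [folklore] -/
theorem lineCoord_self (hW : Nat.card W = p) {w₀ : W} (hw₀ : w₀ ≠ 0) : lineCoord hW hw₀ w₀ = 1 := by
  rw [lineCoord, AddEquiv.symm_apply_eq, zmodAddEquivOfGenerator_apply_one]

omit [TopologicalSpace W] [DiscreteTopology W] in
/-- **Every `w` is `(coordinate of w) · w₀`.** [folklore] -/
theorem val_lineCoord_nsmul (hW : Nat.card W = p) {w₀ : W} (hw₀ : w₀ ≠ 0) (w : W) :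
    (lineCoord hW hw₀ w).val • w₀ = w := by
  have h : (zmodAddEquivOfGenerator (forall_mem_zmultiples_of_card hW hw₀) hW) (lineCoord hW hw₀ w) = w :=
    AddEquiv.apply_symm_apply _ w
  have hx : (((lineCoord hW hw₀ w).val : ℤ) : ZMod p) = lineCoord hW hw₀ w := by
    rw [Int.cast_natCast, ZMod.natCast_zmod_val]
  calc (lineCoord hW hw₀ w).val • w₀ = ((lineCoord hW hw₀ w).val : ℤ) • w₀ := (natCast_zsmul _ _).symm
    _ = (zmodAddEquivOfGenerator (forall_mem_zmultiples_of_card hW hw₀) hW)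
          (((lineCoord hW hw₀ w).val : ℤ) : ZMod p) :=
        (zmodAddEquivOfGenerator_apply_intCast _ _ _).symm
    _ = w := by rw [hx, h]

omit [TopologicalSpace W] [DiscreteTopology W] [Finite W] hp in
/-- `p · w = 0`. [folklore] -/
theorem card_nsmul_eq_zero_of_card (hW : Nat.card W = p) (w : W) : p • w = 0 := by
  rw [← hW]
  exact card_nsmul_eq_zero'

omit [TopologicalSpace Ω] [DiscreteTopology Ω] hp in
/-- `k • x` only depends on `k mod p` when `p • x = 0`. [folklore] -/
theorem mod_nsmul_eq {x : Ω} (hx : p • x = 0) (k : ℕ) : (k % p) • x = k • x := by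
  conv_rhs => rw [← Nat.div_add_mod k p, add_nsmul, mul_nsmul, hx, nsmul_zero, zero_add]

/-- **`Hom(W, Ω) ≃ Ω[p]`, `f ↦ f(w₀)`** (inverse `x ↦ (w ↦ coord(w) · x)`), a continuous linear
equivalence. [folklore] -/
def lineHomEquiv (hW : Nat.card W = p) {w₀ : W} (hw₀ : w₀ ≠ 0) :
    HomCarrier W Ω ≃L[ℤ] Submodule.torsionBy ℤ Ω (p : ℤ) :=
  let e : HomCarrier W Ω ≃+ Submodule.torsionBy ℤ Ω (p : ℤ) :=
    { toFun := fun f => ⟨f w₀, by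
        rw [mem_torsionBy_nsmul_iff, ← map_nsmul, card_nsmul_eq_zero_of_card hW, map_zero]⟩
      invFun := fun x => HomCarrier.ofAddMonoidHom
        { toFun := fun w => (lineCoord hW hw₀ w).val • (x : Ω)
          map_zero' := by rw [map_zero, ZMod.val_zero, zero_nsmul]
          map_add' := fun a b => by
            rw [map_add, ZMod.val_add, mod_nsmul_eq ((mem_torsionBy_nsmul_iff p).1 x.2), add_nsmul] }
      left_inv := fun f => HomCarrier.ext fun w => by
        change (lineCoord hW hw₀ w).val • f w₀ = f w
        rw [← map_nsmul, val_lineCoord_nsmul]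
      right_inv := fun x => Subtype.ext (by
        change (lineCoord hW hw₀ w₀).val • (x : Ω) = x
        rw [lineCoord_self, ZMod.val_one, one_nsmul])
      map_add' := fun f g => Subtype.ext rfl }
  { e.toIntLinearEquiv with
    continuous_toFun := continuous_of_discreteTopology
    continuous_invFun := continuous_of_discreteTopology }

omit [TopologicalSpace W] [DiscreteTopology W] in
/-- Unfolding `lineHomEquiv`. [folklore] -/
@[simp] theorem lineHomEquiv_apply_coe (hW : Nat.card W = p) {w₀ : W} (hw₀ : w₀ ≠ 0) (f : HomCarrier W Ω) :
    ((lineHomEquiv (Ω := Ω) hW hw₀ f : Submodule.torsionBy ℤ Ω (p : ℤ)) : Ω) = f w₀ := rfl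

/-- **`Hom(W, Ω) ≅ Ω[p]` as topological representations** (`W` with trivial action).
[cite: SerreGaloisCohomology1997, II §5.2] -/
def lineHomIso (hτ : ∀ (g : G) (w : W), τ g w = w) (hW : Nat.card W = p) {w₀ : W} (hw₀ : w₀ ≠ 0) :
    (τ.homRep ω).toTopRep ≅ (ω.torsionRep p).toTopRep :=
  topRepIsoOfEquiv (X := (τ.homRep ω).toTopRep) (Y := (ω.torsionRep p).toTopRep)
    (lineHomEquiv hW hw₀) fun g f => Subtype.ext (by
      change (τ.homRep ω g f) w₀ = ω g (f w₀)
      rw [homRep_apply_apply_apply, hτ])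

/-- Through `lineHomIso`, the evaluation `⟨w₀, ·⟩ : Hom(W, Ω) → Ω` is the inclusion `Ω[p] ⊆ Ω`.
[folklore] -/
theorem torsionIncl_lineHomIso_apply (hτ : ∀ (g : G) (w : W), τ g w = w) (hW : Nat.card W = p)
    {w₀ : W} (hw₀ : w₀ ≠ 0) (f : HomCarrier W Ω) :
    (ω.torsionIncl p).hom ((lineHomIso τ ω hτ hW hw₀).hom.hom f) =
      ((τ.evalPairing ω).leftHom w₀ (hτ · w₀)).hom f := rfl

/-- **The `(0, 2)` input of the dévissage from the coefficient module**: if `ι : H²(G, Ω) → ℤ/n`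
and `H²(G, Ω[p]) → H²(G, Ω)` are injective, then for every `W` of prime order `p` with trivial
action, a class `z ∈ H²(G, Hom(W, Ω))` with `ι(H²(⟨w, ·⟩) z) = 0` for all `w` is zero.
[cite: SerreGaloisCohomology1997, II §5.2 Thm. 2 (proof)] -/
theorem zeroTwo_eq_zero_of_torsionIncl_injective {n : ℕ}
    (ι : continuousCohomology 2 ω.toTopRep →+ ZMod n) (hι : Injective ι)
    (hinj : Injective (cohomologyMap (ω.torsionIncl p) 2))
    (hτ : ∀ (g : G) (w : W), τ g w = w) (hW : Nat.card W = p)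
    (z : continuousCohomology 2 (τ.homRep ω).toTopRep)
    (hz : ∀ w : W, τ.zeroTwo ω ι w (hτ · w) z = 0) : z = 0 := by
  obtain ⟨w₀, hw₀⟩ := exists_ne_zero_of_card (W := W) hW
  let e := lineHomIso τ ω hτ hW hw₀
  have h1 : cohomologyMap ((τ.evalPairing ω).leftHom w₀ (hτ · w₀)) 2 z = 0 := by
    apply hι
    rw [map_zero, ← zeroTwo_apply]
    exact hz w₀
  have h2 : cohomologyMap ((τ.evalPairing ω).leftHom w₀ (hτ · w₀)) 2 z =
      cohomologyMap (ω.torsionIncl p) 2 (cohomologyMap e.hom 2 z) :=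
    map_comp_apply_of (ContinuousMonoidHom.id G) (ContinuousMonoidHom.id G) (ContinuousMonoidHom.id G)
      (fun _ => rfl) (resIdHom e.hom) (resIdHom (ω.torsionIncl p))
      (resIdHom ((τ.evalPairing ω).leftHom w₀ (hτ · w₀))) (fun _ => rfl) 2 z
  rw [h2] at h1
  have h3 : cohomologyMap e.hom 2 z = 0 := hinj (by rw [h1, map_zero])
  rw [← cohomologyMap_inv_hom_apply e 2 z]
  change (cohomologyMap e.inv 2).hom ((cohomologyMap e.hom 2) z) = 0
  rw [h3, map_zero]

end Line

end ContinuousRep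

end Literature.NumberTheory.GaloisRepresentations

end
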